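import Mathlib

/-!
# Kernel certificate: the CM types of the admissible factors of `J(X¹₈)` in Shioda's conventions
(p4-k3-fermat-quotient v1 «the hub factors (iv)», the sentence re-checked by p2 — lead INBOX 20:52:53Z (2);
P2-FermatOcticFactor v1; p2-scripts/fermat_orbits.py; seat p2 (g2), pub-hodge-repro0)

Conventions (Sh81 §1 B), §2 (2.1)–(2.5), lit/STATEMENTS-D4.md l. 39–53, frozen D4): `𝔄¹₈ = {(a₀, a₁, a₂) : 1 ≤ aᵢ ≤ 7, Σ aᵢ ≡ 0 (mod 8)}`,
`t·α = (⟨t a₀⟩, ⟨t a₁⟩, ⟨t a₂⟩)` for `t ∈ (ℤ/8)^× = {1, 3, 5, 7}`, `|α| = Σ aᵢ / 8 ∈ {1, 2}`; the admissible factor `A_S` of the orbit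
`S = (ℤ/8)^×·α` has `H^{1,0}(A_S) = ⊕_{|t·α| = 1} W(t·α)`, and by (2.5) the complex multiplication `ζ₈` acts on `W(t·α)` by `λ^t`
if it acts on `W(α)` by `λ`; so the CM type of `A_S` (as a `ℚ(ζ₈)`-type, up to the unit multiple fixed by the choice of `λ`) is
`Φ(α) = {t : |t·α| = 1}`. A CM type `Φ` is induced from the subfield fixed by `Stab(Φ) = {u : uΦ = Φ}`; on `ℚ(ζ₈)`,
`Stab ∋ 3` means the fixed field of `σ₃` = `ℚ(ζ₈ + ζ₈³) = ℚ(√−2)`, `Stab ∋ 5` means `ℚ(ζ₈²) = ℚ(i)`. Certified by `decide`: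
* `card_A`: `#𝔄¹₈ = 42 = 2·g(X¹₈)`;
* `orbit_116` / `cmType_116`: the orbit of `(1, 1, 6)` is `{(1,1,6), (3,3,2), (5,5,6), (7,7,2)}` and `Φ((1,1,6)) = {1, 3}`;
* `stab_116`: `{1, 3}` is stable under `·3` and NOT under `·5` — the factor `A_{(1,1,6)}` is induced from `ℚ(√−2)`, not from `ℚ(i)`;
* `every_type_induced`: EVERY `Φ(α)`, `α ∈ 𝔄¹₈`, is stable under `·3` or under `·5` (no admissible factor of `J(X¹₈)` is a simple surface);
* `half` / `conjugate`: `#Φ(α) = 2` and `|t·α| + |(−t)·α| = 3` (the complementary half is the conjugate type);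
* `tally`: among the 42 triples, 6 have all entries even (`m′ = 4`: the three elliptic factors `E_{ℚ(i)}` pulled back from `X¹₄`),
  12 of the remaining 36 have `Φ` stable under `·5` (three surfaces `∼ E_{ℚ(i)}²`) and 24 have `Φ` stable under `·3`
  (six surfaces `∼ E_{ℚ(√−2)}²`) — hence `J(X¹₈) ∼ E_{ℚ(i)}⁹ × E_{ℚ(√−2)}¹²`, dimension `9 + 12 = 21`.
The passage from «`Φ` induced from `ℚ(√−2)`» to «`A_S ∼ E_{ℚ(√−2)}²`» is the elementary lattice argument of P2-FermatOcticFactor §2,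
not certified here.
-/

namespace HodgeRepro0.FermatOcticOrbit

/-- a triple `(a₀, a₁, a₂)` of residues mod 8 -/
abbrev Triple := Fin 8 × Fin 8 × Fin 8

/-- membership in `𝔄¹₈`: all entries non-zero and `a₀ + a₁ + a₂ ≡ 0 (mod 8)` -/
def inA (α : Triple) : Bool :=
  α.1 != 0 && α.2.1 != 0 && α.2.2 != 0 && ((α.1.val + α.2.1.val + α.2.2.val) % 8 == 0)

/-- `t·α = (⟨t a₀⟩, ⟨t a₁⟩, ⟨t a₂⟩)` (Sh81 (1.3)); for `t` a unit and `α ∈ 𝔄¹₈` the entries stay in `1..7` -/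
def act (t : Fin 8) (α : Triple) : Triple := (t * α.1, t * α.2.1, t * α.2.2)

/-- `|α| = (a₀ + a₁ + a₂)/8` with the representatives `1..7` (Sh81 (1.3)) -/
def absVal (α : Triple) : Nat := (α.1.val + α.2.1.val + α.2.2.val) / 8

/-- the units of `ℤ/8` -/
def units : List (Fin 8) := [1, 3, 5, 7]

/-- the orbit `(ℤ/8)^×·α` -/
def orbit (α : Triple) : List Triple := units.map (fun t => act t α)

/-- the CM type `Φ(α) = {t ∈ (ℤ/8)^× : |t·α| = 1}` -/
def cmType (α : Triple) : List (Fin 8) := units.filter (fun t => absVal (act t α) == 1)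

/-- `Φ(α)` is stable under multiplication by `u` -/
def stabBy (u : Fin 8) (α : Triple) : Bool :=
  ((cmType α).map (fun t => u * t)).all (fun t => (cmType α).contains t)

/-- all entries of `α` even (the orbit then has `m′ = 4`, `A_S` an elliptic curve with CM by `ℤ[i]`) -/
def allEven (α : Triple) : Bool := α.1.val % 2 == 0 && α.2.1.val % 2 == 0 && α.2.2.val % 2 == 0

/-- all 512 triples -/
def allTriples : List Triple :=
  (List.finRange 8).flatMap fun a => (List.finRange 8).flatMap fun b => (List.finRange 8).map fun c => (a, b, c)

/-- the set `𝔄¹₈` as a list -/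
def setA : List Triple := allTriples.filter inA

/-- `#𝔄¹₈ = 42 = 2·genus(X¹₈)` -/
theorem card_A : setA.length = 42 := by decide

/-- the orbit of `(1, 1, 6)` -/
theorem orbit_116 : orbit (1, 1, 6) = [(1, 1, 6), (3, 3, 2), (5, 5, 6), (7, 7, 2)] := by decide

/-- `Φ((1, 1, 6)) = {1, 3}`: `|(1,1,6)| = |(3,3,2)| = 1`, `|(5,5,6)| = |(7,7,2)| = 2` -/
theorem cmType_116 : cmType (1, 1, 6) = [1, 3] := by decide

/-- `{1, 3}` is stable under `·3` (induced from `ℚ(√−2)`) and not under `·5` (not induced from `ℚ(i)`) -/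
theorem stab_116 : stabBy 3 (1, 1, 6) = true ∧ stabBy 5 (1, 1, 6) = false := by decide

/-- every CM type `Φ(α)`, `α ∈ 𝔄¹₈`, is stable under `·3` or under `·5` (a `List.all` over the 42 triples) -/
theorem every_type_induced : setA.all (fun α => stabBy 3 α || stabBy 5 α) = true := by decide

/-- `#Φ(α) = 2` for every `α ∈ 𝔄¹₈` -/
theorem half : setA.all (fun α => (cmType α).length == 2) = true := by decide

/-- `|t·α| + |(−t)·α| = 3` for all `α ∈ 𝔄¹₈`, `t ∈ (ℤ/8)^×`: the complement of `Φ(α)` in `(ℤ/8)^×` is `−Φ(α)` -/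
theorem conjugate :
    setA.all (fun α => units.all (fun t => absVal (act t α) + absVal (act (7 * t) α) == 3)) = true := by decide

/-- the tally: 6 all-even triples (`m′ = 4`), 12 with `Φ` stable under `·5`, 24 with `Φ` stable under `·3` -/
theorem tally :
    (setA.filter allEven).length = 6 ∧
    (setA.filter (fun α => !allEven α && stabBy 5 α)).length = 12 ∧
    (setA.filter (fun α => !allEven α && stabBy 3 α)).length = 24 := by decide

/-- the all-even triples have `Φ` stable under `·5` (they are the characters factoring through `(ℤ/4)^×`) -/
theorem allEven_stab5 : setA.all (fun α => !allEven α || stabBy 5 α) = true := by decide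

/-- no triple of `𝔄¹₈` has `Φ` stable under both `·3` and `·5` unless all entries are even -/
theorem not_both : setA.all (fun α => !(stabBy 3 α && stabBy 5 α) || allEven α) = true := by decide

end HodgeRepro0.FermatOcticOrbit
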